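import Summits.QuantumFields.YangMills.Theorems.BalabanUVNodesN08AtRecord13
import Summits.QuantumFields.YangMills.Theorems.BalabanUVNodesN08UniformO1
import Literature.MathematicalPhysics.QuantumFieldTheory.Balaban1983to89.Node00.Record13LiveSelectorFamily

/-!
# BalabanUVNodes ∕ N08 ON THE STAGE-13 WITNESS FAMILIES OF RECORD — N08's share of K1‴'s nodes stub WITNESSED AT K0a's all-numerics family
# `θ₁₃(n, ε₂₉) = Node00.theta13LiveOfNumerics F N n ε₂₉ …` (every numeric letter open; node00-def-K0a FILE 9 `Node00/Record13LiveSelectorFamily`, p490977) and at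
# the two-letter family `θ₁₃(ε₀, ε₂₉) = Node00.theta13LiveOfFamily₂ …`, where it costs ROW P11 there + `PrintedUV3V N F.L`; and THE SUPPLIER CURRENCIES OF THAT SLOT AT
# THE FAMILY'S OWN BLOCK SIZE `F.L` (Track A, DAG node N08 [Balaban1985UV3] CMP **102** (1985) 255, Thm 1 p. 257 (compact reading) + Thm 2 p. 272; R134 fan-out seat
# `pub-ymgap-dag-n08-c` g7, strategy s2 «knit at the record of record», trigger (t13′) = K0a's new ₁₃ makers + plan g66's all-numerics K0‴ skeleton v5b-NUM13, 2026-08-27)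

WHY THIS FILE.  This seat's ₁₃ storey `BalabanUVNodesN08AtRecord13` (p491313) placed N08's conjunct of the rev-16 nodes-∃ on the WITNESS LINE OF RECORD
`θ₁₃ = Node00.theta13LiveOfRecord F N` (§3 there).  K0a's FILE 9 re-pinned that witness as a MEMBER of two families — `θ₁₃ = θ₁₃(1, ⅛)` of the two-letter family
`theta13LiveOfFamily₂ F N ε₀ ε₂₉` (`Node00.theta13LiveOfRecord_eq_family₂`, `rfl`), itself the member `n := stage12NumericsOfFamily ε₀` of the ALL-NUMERICS family
`theta13LiveOfNumerics F N n ε₂₉` (`Node00.theta13LiveOfFamily₂_eq_numerics`, `rfl`) — and the plan's K0‴ skeleton of record moved to that family (v5b-NUM13: rung I CHOOSES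
`(n, ε₂₉)` with `n.Pos ∧ 0 < ε₂₉` per family `F`, rung MS is read at the same member, composer `Node00.exists_k0_of_bg_theta13LiveOfNumerics`), because row P11 from
[Balaban1985Variational] Thm 1 needs numerics the supplier must be free to choose (node00-def-P11 LOCATED-P11-NUMERICS).  So the θ at which K0‴ will be INHABITED is a member
`θL F n ε₂₉ := theta13LiveOfNumerics F 2 n ε₂₉ (zeta316OfRecord F 2 n.ν n.τ9.M n.A₁) (RzOfRecord F 2) (ZtOfRecord F 2)` chosen by the P11 supplier — and N08's conjunct of
K1‴'s `NodesAtSomeRecord13 F` should be available AT THAT SAME MEMBER, from the same row-P11 text the rungs produce (`bgRow13Num_of`'s conclusion = K0a's socket hypothesis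
`hbg` VERBATIM) plus N08's one slot instance.  The block size of every member is THE FAMILY'S OWN `F.L` (`stage3OfFamily F`), so the slot N08 costs there is `PrintedUV3V N F.L`
— and the three SUPPLIER CURRENCIES of that slot (this seat's p479702 §B, there at the Stage-12 line's `L = 3`) are re-run here at `L := F.L` BY NAME: (u) uniform leaf
systems (dag-n08-a `printedUV3V_of_uniformLeafSystems_at`), (r) «relative to (5)» = Thm 1's bounds (5) in the compact reading as located hypothesis + per-run representation
data (dag-n08-e `printedUV3V_of_thm1Compact_perRun`), (o) per-run data with a run-uniform O(1) (dag-n08-a `printedUV3V_of_perRunUniformO1`).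

WHAT THIS FILE PROVES (kernel bookkeeping BY NAME over p491313 §2 `exists_world₁₃C_b10_main_of_slot` ∕ §1 `b10_main_iff_of_up_pinB10` and K0a FILE 9's faces
`admissible_∕ztUnity_∕slotsNondegenerate₁₃_∕provisos₁₃_…_of_bg` of the two families; 0 `def`, 0 `sorry`).
* §1 AT `θ₁₃(n, ε₂₉)` (record residuals): `theta13LiveOfNumerics_L` (`= F.L`), `_γ` (`= n.γ`) (`rfl`); `exists_world₁₃C_b10_main_at_theta13LiveOfNumerics (hn : n.Pos)
  (hε' : 0 < ε₂₉) (hP : Provisos₁₃) (hUV : PrintedUV3V N F.L)` — a world of the member's datum (`w.γ = n.γ`, `w.L = F.L`) bound over the [B10]-pinned view, a ₁₃C record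
  carrying N08 at every run; `b10_main_iff_at_theta13LiveOfNumerics` (exact cost «in-edges → `PrintedUV3V N F.L`»); at `N = 2`:
  `exists_guarded_record₁₃C_b10_main_of_theta13Numerics_provisos_two` and ★ `exists_guarded_record₁₃C_b10_main_of_bg_numerics_two (hn) (hε') (hbg) (hUV : PrintedUV3V 2 F.L)`
  = N08's conjunct of `NodesAtSomeRecord13 F` WITNESSED AT `θL F n ε₂₉`, `hbg` = ROW P11 at the member in the socket's text.
* §2 AT `θ₁₃(ε₀, ε₂₉)`: `theta13LiveOfFamily₂_L`, `exists_world₁₃C_b10_main_at_theta13LiveOfFamily₂ (hε : 0 < ε₀) (hε')`, `exists_guarded_record₁₃C_b10_main_of_theta13Family₂_provisos_two`,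
  ★ `exists_guarded_record₁₃C_b10_main_of_bg_family₂_two`; membership: p491313 §3's ★ at the witness of record IS §2's ★ at `(1, ⅛)` and §1's ★ at
  `(stage12NumericsOfFamily 1, ⅛)` (`…_of_bg_two_eq_family₂ ∕ _eq_numerics`, by `rfl` on the makers).
* §3 SUPPLIER CURRENCIES AT `L := F.L`: `exists_world₁₃C_b10_main_at_theta13LiveOfNumerics_of_uniformLeafSystemsG ∕ _of_thm1Compact_perRun ∕ _of_perRunUniformO1` (generic `N`),
  ★ `exists_guarded_record₁₃C_b10_main_of_bg_numerics_two_of_uniformLeafSystemsG ∕ _of_thm1Compact_perRun ∕ _of_perRunUniformO1` (at the member, `N = 2`) and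
  `exists_guarded_record₁₃C_b10_main_of_bg_two_of_uniformLeafSystemsG ∕ _of_thm1Compact_perRun ∕ _of_perRunUniformO1` (at the witness of record, p491313 §3 ★ composed):
  «ROW P11 at the member + a version `𝔗 : TFamily₃ 2 F.L` of print's transformations with admissible constants `c : Consts F.L` carrying (u) ∕ (r) ∕ (o) on print's run
  objects `runObjects₀T 2 𝔗 (Backgrounds.ofPrint 2 F.L)` ⟹ N08's conjunct of the ₁₃ nodes-∃» — what a d = 3 lane END theorem must deliver for N08 AT THE RECORD is per-run
  tower objects with leaf systems on the `F.L`-runs plus exactly `h5` (r) or the bound `hO` (o), or uniform constants (u).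
HONEST FRAMING.  Count-neutral; nothing of Bałaban's asserted: `n.Pos`, `0 < ε₂₉` (`0 < ε₀`), row P11 `hbg` ∕ `Provisos₁₃`, and `PrintedUV3V` or its supplier data are
DISPLAYED hypotheses on every theorem; `Node00.PrintedUV3V` is TYPED, NOT PROVED — an inhabitant (the [B10] cluster expansion at print's run objects; dag-n08-d's (α)
programme, class II of `N08-ALPHA-ROWS.md`) remains THE object gap of N08; K0‴ ∕ K1‴ neither proved nor assumed beyond the displayed hypotheses; N08 NOT discharged;
one finite four-torus per run at fixed `ε`, [B10]'s d = 3 lattices inside the record; nothing continuum ∕ ℝ⁴ ∕ OS ∕ mass gap ∕ Clay.  Filed `--supports` K1‴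
`StabilityBAtRecordR13e` (stmt-QuantumFields-19910, route rev 16∕17; dag-lead KEY TABLE WORDS-133∕134) `--as helper`.
Sources: [Balaban1985UV3] Thm 1 p.257, Thm 2 p.272, Sect. D pp.272–275; [Balaban1989LargeFieldII] Thm 1 + (0.1) pp.355–356; [Balaban1988Convergent] Thm 1 p.262,
(2.28) p.259, (3.16)–(3.22) pp.268–269; [Balaban1987RG1] (0.1) p.251, (0.21) p.256, (2.9) p.266; [Balaban1989LargeFieldI] (0.3)–(0.4) p.176; [Balaban1985Averaging] (10) p.19.
-/

noncomputable section

namespace Summit.QuantumFields.YangMills.BalabanUVNodes.N08AtRecord13Family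

open Literature.MathematicalPhysics.QuantumFieldTheory.Balaban1983to89
open Literature.MathematicalPhysics.QuantumFieldTheory.Balaban1983to89.T4Continuum (T4Family FiniteEpsData)
open Literature.MathematicalPhysics.QuantumFieldTheory.Balaban1983to89.DagBinding (WorldP leavesP)
open Literature.MathematicalPhysics.QuantumFieldTheory.Balaban1983to89.Node00
open Literature.MathematicalPhysics.QuantumFieldTheory.Balaban1983to89.B10RunsOfRecord (Consts UniformLeafSystemsG runObjects₀T Backgrounds runsAtG)
open Literature.MathematicalPhysics.QuantumFieldTheory.Balaban1985CMP102
open Literature.MathematicalPhysics.QuantumFieldTheory.Balaban1985CMP102.Setting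
open Literature.MathematicalPhysics.QuantumFieldTheory.Balaban1985CMP102.Theorems (Family)
open Summit.QuantumFields.YangMills.BalabanUVNodes.N08AtRecord13
open Summit.QuantumFields.YangMills.BalabanUVNodes.N08AtRecord9CB10 (printedUV3V_of_uniformLeafSystems_at)
open Summit.QuantumFields.YangMills.Theorems.BalabanUVNodesN08RelativeTo5 (printedUV3V_of_thm1Compact_perRun)
open Summit.QuantumFields.YangMills.Theorems.BalabanUVNodesN08UniformO1 (printedUV3V_of_perRunUniformO1)
open scoped Matrix.Norms.L2Operator

/-! ## §1 ON THE ALL-NUMERICS STAGE-13 WITNESS FAMILY `θ₁₃(n, ε₂₉) = theta13LiveOfNumerics F N n ε₂₉ (zeta316OfRecord F N n.ν n.τ9.M n.A₁) (RzOfRecord F N) (ZtOfRecord F N)`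
(K0b's residuals of record; block size `F.L`, window `n.γ`) — N08's share costs `PrintedUV3V N F.L` -/

section Numerics
variable (F : T4Family) (N : ℕ) [NeZero N] (n : Stage12Numerics) (ε₂₉ : ℝ)

/-- **Every member of the all-numerics family has THE FAMILY'S block size `θ₁₃(n, ε₂₉).L = F.L`** (K0a's maker over `stage3OfFamily F`; `rfl`) — Bałaban's odd `L > 11` of the
four-torus family itself. [cite: Balaban1987RG1, (0.1) p.251 (the numerics of record; bookkeeping)] -/
theorem theta13LiveOfNumerics_L :
    (theta13LiveOfNumerics F N n ε₂₉ (zeta316OfRecord F N n.ν n.τ9.M n.A₁) (RzOfRecord F N) (ZtOfRecord F N)).L = F.L := rfl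

/-- … and window height `θ₁₃(n, ε₂₉).γ = n.γ` (`rfl`; K0a's `theta13OfNumerics_γ` through the live re-pin). [cite: Balaban1987RG1, Thm 1 p.255 (bookkeeping)] -/
theorem theta13LiveOfNumerics_γ :
    (theta13LiveOfNumerics F N n ε₂₉ (zeta316OfRecord F N n.ν n.τ9.M n.A₁) (RzOfRecord F N) (ZtOfRecord F N)).γ = n.γ := rfl

variable {n ε₂₉}

/-- **N08's SHARE OF THE STAGE-13 NODES STUB AT ANY MEMBER `θ₁₃(n, ε₂₉)` COSTS THE SINGLE PROP `PrintedUV3V N F.L`** (plus K0‴'s own provisos `hP` at the member, HYPOTHESIS,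
and the two displayed signs `n.Pos`, `0 < ε₂₉` under which K0a's `admissible_theta13LiveOfNumerics` gives admissibility): a world of the member's datum of record (`w.γ = n.γ`,
`w.L = F.L`), bound over the [B10]-pinned Stage-13 view of the member, that IS a ₁₃C record and carries N08 at every run (p491313 §2 `exists_world₁₃C_b10_main_of_slot`).
At `N = 2`: [Balaban1985UV3] Thm 1-compact ∧ Thm 2 with their printed ∃-prefix for SU(2) at the family's block size `F.L`, at some version of print's transformations.
[cite: Balaban1985UV3, Thm 1 p.257, Thm 2 p.272; Balaban1989LargeFieldII, Thm 1 + (0.1) pp.355–356; Balaban1987RG1, (0.21) p.256, (2.9) p.266 (bookkeeping)] -/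
theorem exists_world₁₃C_b10_main_at_theta13LiveOfNumerics (hn : n.Pos) (hε' : 0 < ε₂₉)
    (hP : (theta13LiveOfNumerics F N n ε₂₉ (zeta316OfRecord F N n.ν n.τ9.M n.A₁) (RzOfRecord F N) (ZtOfRecord F N)).Provisos₁₃ F N)
    (hUV : PrintedUV3V N F.L) :
    ∃ w : WorldP,
      IsRecordOfRecord₁₃C F N
          (datumOfRecord₁₃ F N (theta13LiveOfNumerics F N n ε₂₉ (zeta316OfRecord F N n.ν n.τ9.M n.A₁) (RzOfRecord F N) (ZtOfRecord F N)) hP) w ∧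
        w.γ = n.γ ∧ w.L = (F.L : ℝ) ∧
        (∀ P, w.up P = upOfRecord₅C F N
          (((theta13LiveOfNumerics F N n ε₂₉ (zeta316OfRecord F N n.ν n.τ9.M n.A₁) (RzOfRecord F N) (ZtOfRecord F N)).pinB10 F N).toStage5₁₃ F N) P) ∧
        ∀ P : B12.RunParams, Dag.B10_main (leavesP w P) :=
  have hθ := admissible_theta13LiveOfNumerics F N (zeta316OfRecord F N n.ν n.τ9.M n.A₁) (RzOfRecord F N) (ZtOfRecord F N) hn hε'
  exists_world₁₃C_b10_main_of_slot _ hP hθ (γw := n.γ) ⟨hθ.toStage9.gamma_pos, le_rfl⟩ hUV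

/-- **EXACT COST AT THE MEMBER**: at any world bound over the [B10]-pinned view of `θ₁₃(n, ε₂₉)`, N08 at a run ⟺ «in-edge leaves ⟹ `PrintedUV3V N F.L`». [cite: Balaban1985UV3, Thm 1 p.257, Thm 2 p.272] -/
theorem b10_main_iff_at_theta13LiveOfNumerics {w : WorldP}
    (hup : ∀ P, w.up P = upOfRecord₅C F N
      (((theta13LiveOfNumerics F N n ε₂₉ (zeta316OfRecord F N n.ν n.τ9.M n.A₁) (RzOfRecord F N) (ZtOfRecord F N)).pinB10 F N).toStage5₁₃ F N) P)
    (P : B12.RunParams) :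
    Dag.B10_main (leavesP w P) ↔
      ((leavesP w P).b5 → (leavesP w P).b6 → (leavesP w P).b7 → (leavesP w P).b8 → (leavesP w P).b9 → (leavesP w P).b11 → PrintedUV3V N F.L) :=
  b10_main_iff_of_up_pinB10 _ hup P

/-- **N08's CONJUNCT OF THE STAGE-13 NODES-∃, WITNESSED AT THE MEMBER `θL F n ε₂₉`, `N = 2`** — from K0‴'s open rows at the member (`hP : Provisos₁₃`, HYPOTHESIS), the signs
`n.Pos`, `0 < ε₂₉`, and `PrintedUV3V 2 F.L`: the guard (`ztUnity_theta13LiveOfNumerics`, `slotsNondegenerate₁₃_theta13LiveOfNumerics hP`) and admissibility are K0a's theorems BY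
NAME.  NOT the stub, NOT a discharge. [cite: Balaban1985UV3, Thm 1 p.257, Thm 2 p.272; Balaban1988Convergent, Thm 1 p.262, (3.16)–(3.22) pp.268–269; Balaban1989LargeFieldI, (0.3)–(0.4) p.176 (bookkeeping)] -/
theorem exists_guarded_record₁₃C_b10_main_of_theta13Numerics_provisos_two (F : T4Family) {n : Stage12Numerics} {ε₂₉ : ℝ} (hn : n.Pos) (hε' : 0 < ε₂₉)
    (hP : (theta13LiveOfNumerics F 2 n ε₂₉ (zeta316OfRecord F 2 n.ν n.τ9.M n.A₁) (RzOfRecord F 2) (ZtOfRecord F 2)).Provisos₁₃ F 2)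
    (hUV : PrintedUV3V 2 F.L) :
    ∃ (θ : Stage13Params F 2) (h : θ.Provisos₁₃ F 2) (w : WorldP), (θ.ZtUnity F 2 ∧ θ.SlotsNondegenerate₁₃ F 2) ∧ θ.Admissible F 2 ∧
      IsRecordOfRecord₁₃C F 2 (datumOfRecord₁₃ F 2 θ h) w ∧ ∀ P : B12.RunParams, Dag.B10_main (leavesP w P) := by
  obtain ⟨w, hR, -, -, -, hN⟩ := exists_world₁₃C_b10_main_at_theta13LiveOfNumerics F 2 hn hε' hP hUV
  exact ⟨_, hP, w, ⟨ztUnity_theta13LiveOfNumerics F 2 n ε₂₉, slotsNondegenerate₁₃_theta13LiveOfNumerics F 2 n ε₂₉ _ _ _ hP⟩,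
    admissible_theta13LiveOfNumerics F 2 _ _ _ hn hε', hR, hN⟩

/-- **★ N08's CONJUNCT OF THE STAGE-13 NODES-∃ AT `N = 2`, WITNESSED AT THE MEMBER `θL F n ε₂₉` THE K0‴ RUNGS CHOOSE, FROM EXACTLY: the signs `n.Pos`, `0 < ε₂₉`; ROW P11 `bg`
AT THE MEMBER (verbatim the hypothesis text of K0a's socket `exists_k0_of_bg_theta13LiveOfNumerics` = the conclusion of the plan's glue `bgRow13Num_of` over the two v5b-NUM13
rungs, on the ranged token `BgProvisoΛ`; K0a's `provisos₁₃_theta13LiveOfNumerics_of_bg` supplies every other proviso row by theorem); AND `PrintedUV3V 2 F.L`.**  A REDUCTION —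
NOT a discharge; nothing of Bałaban's asserted. [cite: Balaban1985UV3, Thm 1 p.257, Thm 2 p.272; Balaban1988Convergent, (2.7) p.255, (2.28) p.259, (3.16)–(3.22) pp.268–269; Balaban1989LargeFieldI, (0.3)–(0.4) p.176 (bookkeeping)] -/
theorem exists_guarded_record₁₃C_b10_main_of_bg_numerics_two (F : T4Family) {n : Stage12Numerics} {ε₂₉ : ℝ} (hn : n.Pos) (hε' : 0 < ε₂₉)
    (hbg : ∀ (p : B12.RunParams) (m : ℕ), m ≤ p.K →
      Step.InInterval (theta13OfNumerics F 2 n ε₂₉ (zeta316OfRecord F 2 n.ν n.τ9.M n.A₁) (RzOfRecord F 2) (ZtOfRecord F 2)).γ m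
        (gOfRecord₁₃ F 2 (theta13OfNumerics F 2 n ε₂₉ (zeta316OfRecord F 2 n.ν n.τ9.M n.A₁) (RzOfRecord F 2) (ZtOfRecord F 2)) p) →
      BgProvisoΛ F 2 p.K
        (settingOfRecord₁₃ F 2 (theta13LiveOfNumerics F 2 n ε₂₉ (zeta316OfRecord F 2 n.ν n.τ9.M n.A₁) (RzOfRecord F 2) (ZtOfRecord F 2)) p)
        (RzOfRecord F 2 p.K) n.τ9.M m
        (suppOfRecord₁₃ F 2 (theta13LiveOfNumerics F 2 n ε₂₉ (zeta316OfRecord F 2 n.ν n.τ9.M n.A₁) (RzOfRecord F 2) (ZtOfRecord F 2)) p m)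
        (UbgOfRecord₁₃ F 2 (theta13LiveOfNumerics F 2 n ε₂₉ (zeta316OfRecord F 2 n.ν n.τ9.M n.A₁) (RzOfRecord F 2) (ZtOfRecord F 2)) p m))
    (hUV : PrintedUV3V 2 F.L) :
    ∃ (θ : Stage13Params F 2) (h : θ.Provisos₁₃ F 2) (w : WorldP), (θ.ZtUnity F 2 ∧ θ.SlotsNondegenerate₁₃ F 2) ∧ θ.Admissible F 2 ∧
      IsRecordOfRecord₁₃C F 2 (datumOfRecord₁₃ F 2 θ h) w ∧ ∀ P : B12.RunParams, Dag.B10_main (leavesP w P) :=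
  exists_guarded_record₁₃C_b10_main_of_theta13Numerics_provisos_two F hn hε' (provisos₁₃_theta13LiveOfNumerics_of_bg F 2 n ε₂₉ hbg) hUV

end Numerics

/-! ## §2 ON THE TWO-LETTER STAGE-13 WITNESS FAMILY `θ₁₃(ε₀, ε₂₉) = theta13LiveOfFamily₂ F N ε₀ ε₂₉ (zeta316OfRecord F N (numerics7OfFamily ε₀) 1 1) (RzOfRecord F N) (ZtOfRecord F N)`
(block size `F.L`, window `1∕2`) — the member `n := stage12NumericsOfFamily ε₀` of §1; the witness of record is `(ε₀, ε₂₉) = (1, ⅛)` -/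

section Family₂
variable (F : T4Family) (N : ℕ) [NeZero N] (ε₀ ε₂₉ : ℝ)

/-- Every member of the two-letter family has the family's block size `θ₁₃(ε₀, ε₂₉).L = F.L` (`rfl`). [cite: Balaban1987RG1, (0.1) p.251 (bookkeeping)] -/
theorem theta13LiveOfFamily₂_L :
    (theta13LiveOfFamily₂ F N ε₀ ε₂₉ (zeta316OfRecord F N (numerics7OfFamily ε₀) 1 1) (RzOfRecord F N) (ZtOfRecord F N)).L = F.L := rfl

variable {ε₀ ε₂₉}

/-- **N08's SHARE AT ANY MEMBER `θ₁₃(ε₀, ε₂₉)` COSTS `PrintedUV3V N F.L`** (plus `hP : Provisos₁₃` there and the signs `0 < ε₀`, `0 < ε₂₉`; admissibility is K0a's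
`admissible_theta13LiveOfFamily₂`): a world of the member's datum (`w.γ = 1∕2`, `w.L = F.L`) bound over the [B10]-pinned view, a ₁₃C record carrying N08 at every run.
[cite: Balaban1985UV3, Thm 1 p.257, Thm 2 p.272; Balaban1989LargeFieldII, Thm 1 + (0.1) pp.355–356; Balaban1987RG1, (1.2) p.260, (2.9) p.266 (bookkeeping)] -/
theorem exists_world₁₃C_b10_main_at_theta13LiveOfFamily₂ (hε : 0 < ε₀) (hε' : 0 < ε₂₉)
    (hP : (theta13LiveOfFamily₂ F N ε₀ ε₂₉ (zeta316OfRecord F N (numerics7OfFamily ε₀) 1 1) (RzOfRecord F N) (ZtOfRecord F N)).Provisos₁₃ F N)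
    (hUV : PrintedUV3V N F.L) :
    ∃ w : WorldP,
      IsRecordOfRecord₁₃C F N
          (datumOfRecord₁₃ F N (theta13LiveOfFamily₂ F N ε₀ ε₂₉ (zeta316OfRecord F N (numerics7OfFamily ε₀) 1 1) (RzOfRecord F N) (ZtOfRecord F N)) hP) w ∧
        w.γ = 1 / 2 ∧ w.L = (F.L : ℝ) ∧
        (∀ P, w.up P = upOfRecord₅C F N
          (((theta13LiveOfFamily₂ F N ε₀ ε₂₉ (zeta316OfRecord F N (numerics7OfFamily ε₀) 1 1) (RzOfRecord F N) (ZtOfRecord F N)).pinB10 F N).toStage5₁₃ F N) P) ∧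
        ∀ P : B12.RunParams, Dag.B10_main (leavesP w P) :=
  exists_world₁₃C_b10_main_of_slot _ hP (admissible_theta13LiveOfFamily₂ F N _ _ _ hε hε') (γw := 1 / 2)
    ⟨one_half_pos, (theta13LiveOfFamily₂_γ F N ε₀ ε₂₉ _ _ _).symm.le⟩ hUV

/-- **N08's CONJUNCT OF THE STAGE-13 NODES-∃, WITNESSED AT THE MEMBER `θ₁₃(ε₀, ε₂₉)`, `N = 2`** — from `hP : Provisos₁₃` there (HYPOTHESIS), `0 < ε₀`, `0 < ε₂₉` and
`PrintedUV3V 2 F.L`; guard and admissibility are K0a's theorems BY NAME.  NOT the stub, NOT a discharge. [cite: Balaban1985UV3, Thm 1 p.257, Thm 2 p.272; Balaban1988Convergent, Thm 1 p.262, (3.16)–(3.22) pp.268–269; Balaban1989LargeFieldI, (0.3)–(0.4) p.176 (bookkeeping)] -/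
theorem exists_guarded_record₁₃C_b10_main_of_theta13Family₂_provisos_two (F : T4Family) {ε₀ ε₂₉ : ℝ} (hε : 0 < ε₀) (hε' : 0 < ε₂₉)
    (hP : (theta13LiveOfFamily₂ F 2 ε₀ ε₂₉ (zeta316OfRecord F 2 (numerics7OfFamily ε₀) 1 1) (RzOfRecord F 2) (ZtOfRecord F 2)).Provisos₁₃ F 2)
    (hUV : PrintedUV3V 2 F.L) :
    ∃ (θ : Stage13Params F 2) (h : θ.Provisos₁₃ F 2) (w : WorldP), (θ.ZtUnity F 2 ∧ θ.SlotsNondegenerate₁₃ F 2) ∧ θ.Admissible F 2 ∧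
      IsRecordOfRecord₁₃C F 2 (datumOfRecord₁₃ F 2 θ h) w ∧ ∀ P : B12.RunParams, Dag.B10_main (leavesP w P) := by
  obtain ⟨w, hR, -, -, -, hN⟩ := exists_world₁₃C_b10_main_at_theta13LiveOfFamily₂ F 2 hε hε' hP hUV
  exact ⟨_, hP, w, ⟨ztUnity_theta13LiveOfFamily₂ F 2 ε₀ ε₂₉, slotsNondegenerate₁₃_theta13LiveOfFamily₂ F 2 ε₀ ε₂₉ _ _ _ hP⟩,
    admissible_theta13LiveOfFamily₂ F 2 _ _ _ hε hε', hR, hN⟩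

/-- **★ N08's CONJUNCT OF THE STAGE-13 NODES-∃ AT `N = 2`, WITNESSED AT `θ₁₃(ε₀, ε₂₉)`, FROM: `0 < ε₀`, `0 < ε₂₉`, ROW P11 `bg` AT THE MEMBER (K0a's socket text
`exists_k0_of_bg_theta13LiveOfFamily₂` verbatim) AND `PrintedUV3V 2 F.L`** — the form a consumer carrying displayed `ε₂₉`-smallness ∕ `δ + 4·ε₂₉ ≤ ε₀` instantiates.  A REDUCTION —
NOT a discharge. [cite: Balaban1985UV3, Thm 1 p.257, Thm 2 p.272; Balaban1988Convergent, (2.7) p.255, (2.28) p.259, (3.16)–(3.22) pp.268–269; Balaban1989LargeFieldI, (0.3)–(0.4) p.176 (bookkeeping)] -/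
theorem exists_guarded_record₁₃C_b10_main_of_bg_family₂_two (F : T4Family) {ε₀ ε₂₉ : ℝ} (hε : 0 < ε₀) (hε' : 0 < ε₂₉)
    (hbg : ∀ (p : B12.RunParams) (m : ℕ), m ≤ p.K →
      Step.InInterval (theta13OfFamily₂ F 2 ε₀ ε₂₉ (zeta316OfRecord F 2 (numerics7OfFamily ε₀) 1 1) (RzOfRecord F 2) (ZtOfRecord F 2)).γ m
        (gOfRecord₁₃ F 2 (theta13OfFamily₂ F 2 ε₀ ε₂₉ (zeta316OfRecord F 2 (numerics7OfFamily ε₀) 1 1) (RzOfRecord F 2) (ZtOfRecord F 2)) p) →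
      BgProvisoΛ F 2 p.K
        (settingOfRecord₁₃ F 2 (theta13LiveOfFamily₂ F 2 ε₀ ε₂₉ (zeta316OfRecord F 2 (numerics7OfFamily ε₀) 1 1) (RzOfRecord F 2) (ZtOfRecord F 2)) p)
        (RzOfRecord F 2 p.K) 1 m
        (suppOfRecord₁₃ F 2 (theta13LiveOfFamily₂ F 2 ε₀ ε₂₉ (zeta316OfRecord F 2 (numerics7OfFamily ε₀) 1 1) (RzOfRecord F 2) (ZtOfRecord F 2)) p m)
        (UbgOfRecord₁₃ F 2 (theta13LiveOfFamily₂ F 2 ε₀ ε₂₉ (zeta316OfRecord F 2 (numerics7OfFamily ε₀) 1 1) (RzOfRecord F 2) (ZtOfRecord F 2)) p m))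
    (hUV : PrintedUV3V 2 F.L) :
    ∃ (θ : Stage13Params F 2) (h : θ.Provisos₁₃ F 2) (w : WorldP), (θ.ZtUnity F 2 ∧ θ.SlotsNondegenerate₁₃ F 2) ∧ θ.Admissible F 2 ∧
      IsRecordOfRecord₁₃C F 2 (datumOfRecord₁₃ F 2 θ h) w ∧ ∀ P : B12.RunParams, Dag.B10_main (leavesP w P) :=
  exists_guarded_record₁₃C_b10_main_of_theta13Family₂_provisos_two F hε hε' (provisos₁₃_theta13LiveOfFamily₂_of_bg F 2 ε₀ ε₂₉ hbg) hUV

/-- **MEMBERSHIP, kernel form: the two-letter family's maker IS the all-numerics maker at `n := stage12NumericsOfFamily ε₀`** (K0a's `theta13LiveOfFamily₂_eq_numerics`, `rfl`) — so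
§2's theorems are §1's read at that member, and p491313 §3's witness-of-record theorems are §2's at `(ε₀, ε₂₉) = (eps0OfRecord₁₃, eps29OfFamily eps0OfRecord₁₃) = (1, ⅛)`
(`theta13LiveOfRecord_eq_family₂`). [cite: Balaban1987RG1, (1.2) p.260, (2.9) p.266; Balaban1988Convergent, (2.10) p.256 (bookkeeping)] -/
theorem theta13LiveOfFamily₂_eq_numerics_at_record :
    theta13LiveOfFamily₂ F N ε₀ ε₂₉ (zeta316OfRecord F N (numerics7OfFamily ε₀) 1 1) (RzOfRecord F N) (ZtOfRecord F N) =
      theta13LiveOfNumerics F N (stage12NumericsOfFamily ε₀) ε₂₉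
        (zeta316OfRecord F N (stage12NumericsOfFamily ε₀).ν (stage12NumericsOfFamily ε₀).τ9.M (stage12NumericsOfFamily ε₀).A₁) (RzOfRecord F N) (ZtOfRecord F N) := rfl

/-- … and the witness of record IS the member `(1, ⅛)` of the two-letter family at the record residuals (K0a's `theta13LiveOfRecord_eq_family₂`, `rfl`).
[cite: Balaban1987RG1, (1.2) p.260, (2.9) p.266 (bookkeeping)] -/
theorem theta13LiveOfRecord_eq_family₂_at_record :
    theta13LiveOfRecord F N =
      theta13LiveOfFamily₂ F N eps0OfRecord₁₃ (eps29OfFamily eps0OfRecord₁₃) (zeta316OfRecord F N (numerics7OfFamily eps0OfRecord₁₃) 1 1)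
        (RzOfRecord F N) (ZtOfRecord F N) := rfl

end Family₂

/-! ## §3 THE SUPPLIER CURRENCIES OF THE SLOT AT THE FAMILY'S OWN BLOCK SIZE `F.L` — (u) uniform leaf systems, (r) «relative to (5)», (o) per-run data with a run-uniform
O(1) — on print's `F.L`-runs `runObjects₀T N 𝔗 (Backgrounds.ofPrint N F.L)` at a version `𝔗 : TFamily₃ N F.L` of print's transformations (2) -/

section SupplierNumerics
variable (F : T4Family) (N : ℕ) [NeZero N] {n : Stage12Numerics} {ε₂₉ : ℝ}

/-- **CURRENCY (u) AT THE MEMBER `θ₁₃(n, ε₂₉)` — UNIFORM LEAF SYSTEMS AT BLOCK SIZE `F.L`**: a version `𝔗` of print's transformations on the `F.L`-runs, admissible constants `c`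
and uniform leaf systems on print's run objects give N08's world at the member's datum (dag-n08-a's supplier face `printedUV3V_of_uniformLeafSystems_at` BY NAME into §1).
[cite: Balaban1985UV3, Thm 1 p.257, Thm 2 p.272, Sect. D pp.272–275; Balaban1985Averaging, (10) p.19] -/
theorem exists_world₁₃C_b10_main_at_theta13LiveOfNumerics_of_uniformLeafSystemsG (hn : n.Pos) (hε' : 0 < ε₂₉)
    (hP : (theta13LiveOfNumerics F N n ε₂₉ (zeta316OfRecord F N n.ν n.τ9.M n.A₁) (RzOfRecord F N) (ZtOfRecord F N)).Provisos₁₃ F N)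
    (𝔗 : TFamily₃ N F.L) (c : Consts F.L) (hc : c.Adm) (hU : UniformLeafSystemsG N (runObjects₀T N 𝔗 (Backgrounds.ofPrint N F.L)) c) :
    ∃ w : WorldP,
      IsRecordOfRecord₁₃C F N
          (datumOfRecord₁₃ F N (theta13LiveOfNumerics F N n ε₂₉ (zeta316OfRecord F N n.ν n.τ9.M n.A₁) (RzOfRecord F N) (ZtOfRecord F N)) hP) w ∧
        w.γ = n.γ ∧ w.L = (F.L : ℝ) ∧
        (∀ P, w.up P = upOfRecord₅C F N
          (((theta13LiveOfNumerics F N n ε₂₉ (zeta316OfRecord F N n.ν n.τ9.M n.A₁) (RzOfRecord F N) (ZtOfRecord F N)).pinB10 F N).toStage5₁₃ F N) P) ∧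
        ∀ P : B12.RunParams, Dag.B10_main (leavesP w P) :=
  exists_world₁₃C_b10_main_at_theta13LiveOfNumerics F N hn hε' hP (printedUV3V_of_uniformLeafSystems_at 𝔗 ⟨c, hc, hU⟩)

/-- **CURRENCY (r) AT THE MEMBER — «RELATIVE TO (5)»**: a version `𝔗`, admissible constants `c`, Thm 1's bounds (5) in the compact reading on the `F.L`-runs (LOCATED HYPOTHESIS
`h5`, print's «O(1) independent of ε, k», p. 257 L1) and per-run representation data `hdata` give N08's world at the member's datum (dag-n08-e's supplier face
`printedUV3V_of_thm1Compact_perRun` BY NAME). [cite: Balaban1985UV3, Thm 1 p.257 (compact reading), Thm 2 p.272, Sect. D pp.272–275] -/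
theorem exists_world₁₃C_b10_main_at_theta13LiveOfNumerics_of_thm1Compact_perRun (hn : n.Pos) (hε' : 0 < ε₂₉)
    (hP : (theta13LiveOfNumerics F N n ε₂₉ (zeta316OfRecord F N n.ν n.τ9.M n.A₁) (RzOfRecord F N) (ZtOfRecord F N)).Provisos₁₃ F N)
    (𝔗 : TFamily₃ N F.L) (c : Consts F.L) (hc : c.Adm)
    (h5 : B10.Thm1PrintedCompact (runsAtG N (runObjects₀T N 𝔗 (Backgrounds.ofPrint N F.L)) c))
    (hdata : ∀ S : Family F.L c.eps0, ∃ (C : B10Assembly.Consts) (W : SectB.TowerObjects S.1 (SU N)),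
      W.toRunObjects = runObjects₀T N 𝔗 (Backgrounds.ofPrint N F.L) c S.1 ∧ Nonempty (B10Assembly.LeafSystem C W.pin.toTowerRun)) :
    ∃ w : WorldP,
      IsRecordOfRecord₁₃C F N
          (datumOfRecord₁₃ F N (theta13LiveOfNumerics F N n ε₂₉ (zeta316OfRecord F N n.ν n.τ9.M n.A₁) (RzOfRecord F N) (ZtOfRecord F N)) hP) w ∧
        w.γ = n.γ ∧ w.L = (F.L : ℝ) ∧
        (∀ P, w.up P = upOfRecord₅C F N
          (((theta13LiveOfNumerics F N n ε₂₉ (zeta316OfRecord F N n.ν n.τ9.M n.A₁) (RzOfRecord F N) (ZtOfRecord F N)).pinB10 F N).toStage5₁₃ F N) P) ∧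
        ∀ P : B12.RunParams, Dag.B10_main (leavesP w P) :=
  exists_world₁₃C_b10_main_at_theta13LiveOfNumerics F N hn hε' hP (printedUV3V_of_thm1Compact_perRun N F.L 𝔗 c hc h5 hdata)

/-- **CURRENCY (o) AT THE MEMBER — PER-RUN DATA WITH A RUN-UNIFORM O(1)**: a version `𝔗`, admissible constants `c`, and per-run representation data on the `F.L`-runs whose
displayed O(1) is bounded by one `O` across the family give N08's world at the member's datum (dag-n08-a's sharpest data currency `printedUV3V_of_perRunUniformO1` BY NAME).
[cite: Balaban1985UV3, Thm 1 p.257 L1, Thm 2 p.272, Sect. D pp.272–274] -/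
theorem exists_world₁₃C_b10_main_at_theta13LiveOfNumerics_of_perRunUniformO1 (hn : n.Pos) (hε' : 0 < ε₂₉)
    (hP : (theta13LiveOfNumerics F N n ε₂₉ (zeta316OfRecord F N n.ν n.τ9.M n.A₁) (RzOfRecord F N) (ZtOfRecord F N)).Provisos₁₃ F N)
    (𝔗 : TFamily₃ N F.L) (c : Consts F.L) (hc : c.Adm) (O : ℝ → ℝ → ℝ)
    (h : ∀ S : Family F.L c.eps0, ∃ (C : B10Assembly.Consts) (W : SectB.TowerObjects S.1 (SU N)),
      W.toRunObjects = runObjects₀T N 𝔗 (Backgrounds.ofPrint N F.L) c S.1 ∧ Nonempty (B10Assembly.LeafSystem C W.pin.toTowerRun) ∧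
        ∀ gmin gmax : ℝ, 0 < gmin → gmin ≤ gmax → B10Assembly.O1 C gmin gmax ≤ O gmin gmax) :
    ∃ w : WorldP,
      IsRecordOfRecord₁₃C F N
          (datumOfRecord₁₃ F N (theta13LiveOfNumerics F N n ε₂₉ (zeta316OfRecord F N n.ν n.τ9.M n.A₁) (RzOfRecord F N) (ZtOfRecord F N)) hP) w ∧
        w.γ = n.γ ∧ w.L = (F.L : ℝ) ∧
        (∀ P, w.up P = upOfRecord₅C F N
          (((theta13LiveOfNumerics F N n ε₂₉ (zeta316OfRecord F N n.ν n.τ9.M n.A₁) (RzOfRecord F N) (ZtOfRecord F N)).pinB10 F N).toStage5₁₃ F N) P) ∧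
        ∀ P : B12.RunParams, Dag.B10_main (leavesP w P) :=
  exists_world₁₃C_b10_main_at_theta13LiveOfNumerics F N hn hε' hP (printedUV3V_of_perRunUniformO1 N F.L 𝔗 c hc O h)

end SupplierNumerics

section SupplierGuarded
variable (F : T4Family) {n : Stage12Numerics} {ε₂₉ : ℝ}

/-- **★ CURRENCY (u) INTO N08's CONJUNCT OF THE ₁₃ NODES-∃ AT THE MEMBER `θL F n ε₂₉`, `N = 2`**: the signs, ROW P11 at the member, and — in place of `PrintedUV3V 2 F.L` — a
version `𝔗 : TFamily₃ 2 F.L` of print's transformations with admissible constants and UNIFORM LEAF SYSTEMS on print's `F.L`-run objects for SU(2).  What a d = 3 lane END theorem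
must deliver for N08 AT THE RECORD, in n08-a's uniform currency. [cite: Balaban1985UV3, Thm 1 p.257, Thm 2 p.272, Sect. D pp.272–275; Balaban1988Convergent, (2.28) p.259, (3.16)–(3.22) pp.268–269 (bookkeeping)] -/
theorem exists_guarded_record₁₃C_b10_main_of_bg_numerics_two_of_uniformLeafSystemsG (hn : n.Pos) (hε' : 0 < ε₂₉)
    (hbg : ∀ (p : B12.RunParams) (m : ℕ), m ≤ p.K →
      Step.InInterval (theta13OfNumerics F 2 n ε₂₉ (zeta316OfRecord F 2 n.ν n.τ9.M n.A₁) (RzOfRecord F 2) (ZtOfRecord F 2)).γ m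
        (gOfRecord₁₃ F 2 (theta13OfNumerics F 2 n ε₂₉ (zeta316OfRecord F 2 n.ν n.τ9.M n.A₁) (RzOfRecord F 2) (ZtOfRecord F 2)) p) →
      BgProvisoΛ F 2 p.K
        (settingOfRecord₁₃ F 2 (theta13LiveOfNumerics F 2 n ε₂₉ (zeta316OfRecord F 2 n.ν n.τ9.M n.A₁) (RzOfRecord F 2) (ZtOfRecord F 2)) p)
        (RzOfRecord F 2 p.K) n.τ9.M m
        (suppOfRecord₁₃ F 2 (theta13LiveOfNumerics F 2 n ε₂₉ (zeta316OfRecord F 2 n.ν n.τ9.M n.A₁) (RzOfRecord F 2) (ZtOfRecord F 2)) p m)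
        (UbgOfRecord₁₃ F 2 (theta13LiveOfNumerics F 2 n ε₂₉ (zeta316OfRecord F 2 n.ν n.τ9.M n.A₁) (RzOfRecord F 2) (ZtOfRecord F 2)) p m))
    (𝔗 : TFamily₃ 2 F.L) (c : Consts F.L) (hc : c.Adm) (hU : UniformLeafSystemsG 2 (runObjects₀T 2 𝔗 (Backgrounds.ofPrint 2 F.L)) c) :
    ∃ (θ : Stage13Params F 2) (h : θ.Provisos₁₃ F 2) (w : WorldP), (θ.ZtUnity F 2 ∧ θ.SlotsNondegenerate₁₃ F 2) ∧ θ.Admissible F 2 ∧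
      IsRecordOfRecord₁₃C F 2 (datumOfRecord₁₃ F 2 θ h) w ∧ ∀ P : B12.RunParams, Dag.B10_main (leavesP w P) :=
  exists_guarded_record₁₃C_b10_main_of_bg_numerics_two F hn hε' hbg (printedUV3V_of_uniformLeafSystems_at 𝔗 ⟨c, hc, hU⟩)

/-- **★ CURRENCY (r) INTO N08's CONJUNCT AT THE MEMBER, `N = 2`** — the signs, ROW P11 at the member, a version `𝔗`, admissible `c`, Thm 1's bounds (5) in the compact reading
on the `F.L`-runs for SU(2) (LOCATED HYPOTHESIS `h5`) and per-run representation data `hdata` (n08-e's currency: what the END theorem must add to its per-run towers is exactly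
`h5`). [cite: Balaban1985UV3, Thm 1 p.257 (compact reading), Thm 2 p.272, Sect. D pp.272–275; Balaban1988Convergent, (2.28) p.259, (3.16)–(3.22) pp.268–269 (bookkeeping)] -/
theorem exists_guarded_record₁₃C_b10_main_of_bg_numerics_two_of_thm1Compact_perRun (hn : n.Pos) (hε' : 0 < ε₂₉)
    (hbg : ∀ (p : B12.RunParams) (m : ℕ), m ≤ p.K →
      Step.InInterval (theta13OfNumerics F 2 n ε₂₉ (zeta316OfRecord F 2 n.ν n.τ9.M n.A₁) (RzOfRecord F 2) (ZtOfRecord F 2)).γ m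
        (gOfRecord₁₃ F 2 (theta13OfNumerics F 2 n ε₂₉ (zeta316OfRecord F 2 n.ν n.τ9.M n.A₁) (RzOfRecord F 2) (ZtOfRecord F 2)) p) →
      BgProvisoΛ F 2 p.K
        (settingOfRecord₁₃ F 2 (theta13LiveOfNumerics F 2 n ε₂₉ (zeta316OfRecord F 2 n.ν n.τ9.M n.A₁) (RzOfRecord F 2) (ZtOfRecord F 2)) p)
        (RzOfRecord F 2 p.K) n.τ9.M m
        (suppOfRecord₁₃ F 2 (theta13LiveOfNumerics F 2 n ε₂₉ (zeta316OfRecord F 2 n.ν n.τ9.M n.A₁) (RzOfRecord F 2) (ZtOfRecord F 2)) p m)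
        (UbgOfRecord₁₃ F 2 (theta13LiveOfNumerics F 2 n ε₂₉ (zeta316OfRecord F 2 n.ν n.τ9.M n.A₁) (RzOfRecord F 2) (ZtOfRecord F 2)) p m))
    (𝔗 : TFamily₃ 2 F.L) (c : Consts F.L) (hc : c.Adm)
    (h5 : B10.Thm1PrintedCompact (runsAtG 2 (runObjects₀T 2 𝔗 (Backgrounds.ofPrint 2 F.L)) c))
    (hdata : ∀ S : Family F.L c.eps0, ∃ (C : B10Assembly.Consts) (W : SectB.TowerObjects S.1 (SU 2)),
      W.toRunObjects = runObjects₀T 2 𝔗 (Backgrounds.ofPrint 2 F.L) c S.1 ∧ Nonempty (B10Assembly.LeafSystem C W.pin.toTowerRun)) :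
    ∃ (θ : Stage13Params F 2) (h : θ.Provisos₁₃ F 2) (w : WorldP), (θ.ZtUnity F 2 ∧ θ.SlotsNondegenerate₁₃ F 2) ∧ θ.Admissible F 2 ∧
      IsRecordOfRecord₁₃C F 2 (datumOfRecord₁₃ F 2 θ h) w ∧ ∀ P : B12.RunParams, Dag.B10_main (leavesP w P) :=
  exists_guarded_record₁₃C_b10_main_of_bg_numerics_two F hn hε' hbg (printedUV3V_of_thm1Compact_perRun 2 F.L 𝔗 c hc h5 hdata)

/-- **★ CURRENCY (o) INTO N08's CONJUNCT AT THE MEMBER, `N = 2`** — the signs, ROW P11 at the member, a version `𝔗`, admissible `c`, and per-run representation data on the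
`F.L`-runs for SU(2) whose displayed O(1) is bounded by one `O` across the family (n08-a's sharpest data currency). [cite: Balaban1985UV3, Thm 1 p.257 L1, Thm 2 p.272, Sect. D pp.272–274; Balaban1988Convergent, (2.28) p.259, (3.16)–(3.22) pp.268–269 (bookkeeping)] -/
theorem exists_guarded_record₁₃C_b10_main_of_bg_numerics_two_of_perRunUniformO1 (hn : n.Pos) (hε' : 0 < ε₂₉)
    (hbg : ∀ (p : B12.RunParams) (m : ℕ), m ≤ p.K →
      Step.InInterval (theta13OfNumerics F 2 n ε₂₉ (zeta316OfRecord F 2 n.ν n.τ9.M n.A₁) (RzOfRecord F 2) (ZtOfRecord F 2)).γ m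
        (gOfRecord₁₃ F 2 (theta13OfNumerics F 2 n ε₂₉ (zeta316OfRecord F 2 n.ν n.τ9.M n.A₁) (RzOfRecord F 2) (ZtOfRecord F 2)) p) →
      BgProvisoΛ F 2 p.K
        (settingOfRecord₁₃ F 2 (theta13LiveOfNumerics F 2 n ε₂₉ (zeta316OfRecord F 2 n.ν n.τ9.M n.A₁) (RzOfRecord F 2) (ZtOfRecord F 2)) p)
        (RzOfRecord F 2 p.K) n.τ9.M m
        (suppOfRecord₁₃ F 2 (theta13LiveOfNumerics F 2 n ε₂₉ (zeta316OfRecord F 2 n.ν n.τ9.M n.A₁) (RzOfRecord F 2) (ZtOfRecord F 2)) p m)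
        (UbgOfRecord₁₃ F 2 (theta13LiveOfNumerics F 2 n ε₂₉ (zeta316OfRecord F 2 n.ν n.τ9.M n.A₁) (RzOfRecord F 2) (ZtOfRecord F 2)) p m))
    (𝔗 : TFamily₃ 2 F.L) (c : Consts F.L) (hc : c.Adm) (O : ℝ → ℝ → ℝ)
    (h : ∀ S : Family F.L c.eps0, ∃ (C : B10Assembly.Consts) (W : SectB.TowerObjects S.1 (SU 2)),
      W.toRunObjects = runObjects₀T 2 𝔗 (Backgrounds.ofPrint 2 F.L) c S.1 ∧ Nonempty (B10Assembly.LeafSystem C W.pin.toTowerRun) ∧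
        ∀ gmin gmax : ℝ, 0 < gmin → gmin ≤ gmax → B10Assembly.O1 C gmin gmax ≤ O gmin gmax) :
    ∃ (θ : Stage13Params F 2) (h : θ.Provisos₁₃ F 2) (w : WorldP), (θ.ZtUnity F 2 ∧ θ.SlotsNondegenerate₁₃ F 2) ∧ θ.Admissible F 2 ∧
      IsRecordOfRecord₁₃C F 2 (datumOfRecord₁₃ F 2 θ h) w ∧ ∀ P : B12.RunParams, Dag.B10_main (leavesP w P) :=
  exists_guarded_record₁₃C_b10_main_of_bg_numerics_two F hn hε' hbg (printedUV3V_of_perRunUniformO1 2 F.L 𝔗 c hc O h)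

end SupplierGuarded

section SupplierRecord
variable (F : T4Family)

/-- **★ CURRENCY (u) INTO N08's CONJUNCT AT THE WITNESS OF RECORD `θ₁₃ = theta13LiveOfRecord F 2`** (p491313 §3 ★ `exists_guarded_record₁₃C_b10_main_of_bg_two` composed with
n08-a's supplier face at `L := F.L`): ROW P11 at `θ₁₃` + a version `𝔗 : TFamily₃ 2 F.L` with admissible constants and uniform leaf systems on print's `F.L`-run objects.
[cite: Balaban1985UV3, Thm 1 p.257, Thm 2 p.272, Sect. D pp.272–275; Balaban1988Convergent, (2.28) p.259, (3.16)–(3.22) pp.268–269 (bookkeeping)] -/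
theorem exists_guarded_record₁₃C_b10_main_of_bg_two_of_uniformLeafSystemsG
    (hbg : ∀ (p : B12.RunParams) (n : ℕ), n ≤ p.K →
      Step.InInterval (theta13LiveOfRecord F 2).γ n (gOfRecord₁₃ F 2 (theta13LiveOfRecord F 2) p) →
        BgProvisoΛ F 2 p.K (settingOfRecord₁₃ F 2 (theta13LiveOfRecord F 2) p) ((theta13LiveOfRecord F 2).Rz p.K) (theta13LiveOfRecord F 2).τ9.M n
          (suppOfRecord₁₃ F 2 (theta13LiveOfRecord F 2) p n) (UbgOfRecord₁₃ F 2 (theta13LiveOfRecord F 2) p n))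
    (𝔗 : TFamily₃ 2 F.L) (c : Consts F.L) (hc : c.Adm) (hU : UniformLeafSystemsG 2 (runObjects₀T 2 𝔗 (Backgrounds.ofPrint 2 F.L)) c) :
    ∃ (θ : Stage13Params F 2) (h : θ.Provisos₁₃ F 2) (w : WorldP), (θ.ZtUnity F 2 ∧ θ.SlotsNondegenerate₁₃ F 2) ∧ θ.Admissible F 2 ∧
      IsRecordOfRecord₁₃C F 2 (datumOfRecord₁₃ F 2 θ h) w ∧ ∀ P : B12.RunParams, Dag.B10_main (leavesP w P) :=
  exists_guarded_record₁₃C_b10_main_of_bg_two F hbg (printedUV3V_of_uniformLeafSystems_at 𝔗 ⟨c, hc, hU⟩)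

/-- **★ CURRENCY (r) INTO N08's CONJUNCT AT THE WITNESS OF RECORD** — ROW P11 at `θ₁₃`, a version `𝔗`, admissible `c`, Thm 1's bounds (5) in the compact reading on the `F.L`-runs
for SU(2) (LOCATED HYPOTHESIS `h5`) and per-run representation data. [cite: Balaban1985UV3, Thm 1 p.257 (compact reading), Thm 2 p.272, Sect. D pp.272–275; Balaban1988Convergent, (2.28) p.259, (3.16)–(3.22) pp.268–269 (bookkeeping)] -/
theorem exists_guarded_record₁₃C_b10_main_of_bg_two_of_thm1Compact_perRun
    (hbg : ∀ (p : B12.RunParams) (n : ℕ), n ≤ p.K →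
      Step.InInterval (theta13LiveOfRecord F 2).γ n (gOfRecord₁₃ F 2 (theta13LiveOfRecord F 2) p) →
        BgProvisoΛ F 2 p.K (settingOfRecord₁₃ F 2 (theta13LiveOfRecord F 2) p) ((theta13LiveOfRecord F 2).Rz p.K) (theta13LiveOfRecord F 2).τ9.M n
          (suppOfRecord₁₃ F 2 (theta13LiveOfRecord F 2) p n) (UbgOfRecord₁₃ F 2 (theta13LiveOfRecord F 2) p n))
    (𝔗 : TFamily₃ 2 F.L) (c : Consts F.L) (hc : c.Adm)
    (h5 : B10.Thm1PrintedCompact (runsAtG 2 (runObjects₀T 2 𝔗 (Backgrounds.ofPrint 2 F.L)) c))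
    (hdata : ∀ S : Family F.L c.eps0, ∃ (C : B10Assembly.Consts) (W : SectB.TowerObjects S.1 (SU 2)),
      W.toRunObjects = runObjects₀T 2 𝔗 (Backgrounds.ofPrint 2 F.L) c S.1 ∧ Nonempty (B10Assembly.LeafSystem C W.pin.toTowerRun)) :
    ∃ (θ : Stage13Params F 2) (h : θ.Provisos₁₃ F 2) (w : WorldP), (θ.ZtUnity F 2 ∧ θ.SlotsNondegenerate₁₃ F 2) ∧ θ.Admissible F 2 ∧
      IsRecordOfRecord₁₃C F 2 (datumOfRecord₁₃ F 2 θ h) w ∧ ∀ P : B12.RunParams, Dag.B10_main (leavesP w P) :=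
  exists_guarded_record₁₃C_b10_main_of_bg_two F hbg (printedUV3V_of_thm1Compact_perRun 2 F.L 𝔗 c hc h5 hdata)

/-- **★ CURRENCY (o) INTO N08's CONJUNCT AT THE WITNESS OF RECORD** — ROW P11 at `θ₁₃`, a version `𝔗`, admissible `c`, per-run representation data on the `F.L`-runs for SU(2)
with a run-uniform O(1). [cite: Balaban1985UV3, Thm 1 p.257 L1, Thm 2 p.272, Sect. D pp.272–274; Balaban1988Convergent, (2.28) p.259, (3.16)–(3.22) pp.268–269 (bookkeeping)] -/
theorem exists_guarded_record₁₃C_b10_main_of_bg_two_of_perRunUniformO1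
    (hbg : ∀ (p : B12.RunParams) (n : ℕ), n ≤ p.K →
      Step.InInterval (theta13LiveOfRecord F 2).γ n (gOfRecord₁₃ F 2 (theta13LiveOfRecord F 2) p) →
        BgProvisoΛ F 2 p.K (settingOfRecord₁₃ F 2 (theta13LiveOfRecord F 2) p) ((theta13LiveOfRecord F 2).Rz p.K) (theta13LiveOfRecord F 2).τ9.M n
          (suppOfRecord₁₃ F 2 (theta13LiveOfRecord F 2) p n) (UbgOfRecord₁₃ F 2 (theta13LiveOfRecord F 2) p n))
    (𝔗 : TFamily₃ 2 F.L) (c : Consts F.L) (hc : c.Adm) (O : ℝ → ℝ → ℝ)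
    (h : ∀ S : Family F.L c.eps0, ∃ (C : B10Assembly.Consts) (W : SectB.TowerObjects S.1 (SU 2)),
      W.toRunObjects = runObjects₀T 2 𝔗 (Backgrounds.ofPrint 2 F.L) c S.1 ∧ Nonempty (B10Assembly.LeafSystem C W.pin.toTowerRun) ∧
        ∀ gmin gmax : ℝ, 0 < gmin → gmin ≤ gmax → B10Assembly.O1 C gmin gmax ≤ O gmin gmax) :
    ∃ (θ : Stage13Params F 2) (h : θ.Provisos₁₃ F 2) (w : WorldP), (θ.ZtUnity F 2 ∧ θ.SlotsNondegenerate₁₃ F 2) ∧ θ.Admissible F 2 ∧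
      IsRecordOfRecord₁₃C F 2 (datumOfRecord₁₃ F 2 θ h) w ∧ ∀ P : B12.RunParams, Dag.B10_main (leavesP w P) :=
  exists_guarded_record₁₃C_b10_main_of_bg_two F hbg (printedUV3V_of_perRunUniformO1 2 F.L 𝔗 c hc O h)

end SupplierRecord

end Summit.QuantumFields.YangMills.BalabanUVNodes.N08AtRecord13Family

end
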